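import Literature.NumberTheory.EllipticCurves.ZpExtensionEisensteinTwistedFilH2VanishingProofs
import Literature.NumberTheory.EllipticCurves.ZpExtensionEisensteinDVRSetting
import Literature.NumberTheory.EllipticCurves.TorsionFilAtAdaptedBasisProofs
import Literature.NumberTheory.EllipticCurves.ZpExtensionEisensteinTwistFreeProofs
import Literature.NumberTheory.GaloisCohomology.Howard2004.SelmerTriples
import Literature.NumberTheory.GaloisRepresentations.ContinuousCohomologyConnecting
import Literature.NumberTheory.GaloisRepresentations.PPrimaryDevissage
import HarnessLib

/-!
# The residual lift at a place above `p`, I: purity `ker π̄ ∩ (A ⊗ Fil) = [T]·(A ⊗ Fil)` and Hom-dévissage on the kernel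
# (theorems only; no definition, no named fact, no instance, no `sorry`)

Topic `NumberTheory/EllipticCurves` (D1 road of cell `pub/bsd-print-x9`; brick (C1-lift) of seat `bsd-line-x10b-p1-w8` g2's (H5B-P) = the
hypothesis `hliftbar` of `ZpExtension.propagate_eisensteinSelmerStructure_one_eq_strictSubgroup` (`ZpExtensionEisensteinOrdinaryResidualStrictProofs`)
for the curve's Eisenstein tower at a place `w ∋ p` of good reduction with an ordinary point).

Howard [B. Howard, Compositio Math. 140 (2004), Lemma 3.2.7, arXiv:1202.6340 p. 16 L150–156]: the cokernel of
`H¹(K_v, Fil_v 𝐓) → H¹(K_v, Fil_v(T) ⊗ Λ/𝔭)` is controlled by an `H²` of a `Fil`-type module and «by local duality it suffices to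
bound» the `p`-torsion of `Ẽ_v` over the residue field — zero in the NON-ANOMALOUS case.  Here, for the residual presentation
`π̄ : W₁ = E[p] ⊗ A_{m,1}(ψ) ↠ E[p]` (`Howard2004.IsQuotientBy` by `([T])`, `E[p]` an `A_{m,1}`-module through the residue character,
`π̄(1 ⊗ a) = a`) and the ordinary line `Fil_w E[p] = E[p] ∩ E₁(K̄_w)` (`torsionFilAt`):

* §1 `π̄ (A ⊗ Fil_w E[p]) = Fil_w E[p]` (`πbar_mem_torsionFilAt_of_mem_twistedFil`, `exists_mem_twistedFil_πbar_eq`).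
* §2 PURITY **`exists_eq_mk_X_smul_of_πbar_eq_zero`**: `x ∈ A ⊗ Fil`, `π̄ x = 0 ⇒ x = [T] • y` with `y ∈ A ⊗ Fil` — in the `A_{m,1}`-basis of
  `W₁` adapted to `Fil_w E[p]` (x9-p1-w3's `exists_addEquiv_mem_torsionFilAt_iff` + `Twisted.basisOfAddEquiv`) `A ⊗ Fil` is the coordinate
  line `{repr · 1 = 0}` and `ker π̄ = [T] W₁` (`IsQuotientBy.ker_eq`).
* §3 (generic tower `(M_k, t_k)` with ordinary datum `Φ`, residual presentation `π̄ : W₁ ↠ N` by `([T])`, PURITY as a hypothesis)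
  **`ZpExtension.OrdinaryFiltration.forall_equivariant_ker_restrict_eq_zero`** — Hom-dévissage on the kernel
  `K = {x ∈ A ⊗ Fil_w M₁ | π̄ x = 0} = [T]·(A ⊗ Fil)` (the induction of `OrdinaryFiltration.forall_equivariant_twistedFil_one_eq_zero`
  restarted at `[T]^1`): every `Γ_w`-equivariant additive `K → Ω` vanishes if every `Γ_w`-equivariant additive `Fil_w M₁ → Ω` does.
  The sequel (`H²(K_w, K) = 0` by local duality and the surjectivity of `H¹(K_w, A ⊗ Fil) → H¹(K_w, Fil_w T̄)`, i.e. the binder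
  `hliftbar` of `ZpExtension.propagate_eisensteinSelmerStructure_one_eq_strictSubgroup`) is the next file.

No summit statement is proved; BSD is not proved by any of this.

References: [Howard2004HeegnerKolyvagin] Lemma 3.2.7, §3.1 (arXiv:1202.6340 p. 16 L150–156, p. 15 L56–66); [MilneADT2006] I Cor. 2.3;
[SerreGaloisCohomology1997] I §2.2, II §5.2; [GreenbergLNM1716] §2.
-/

set_option autoImplicit false

noncomputable section

open Function NumberField IsDedekindDomain Field
open scoped NumberField TensorProduct ContRepresentation

namespace WeierstrassCurve

open Literature.NumberTheory.EllipticCurves Literature.NumberTheory.GaloisRepresentations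
open Literature.NumberTheory.GaloisRepresentations.DiscreteGaloisModule
open Literature.NumberTheory.GaloisCohomology.Howard2004
open Literature.NumberTheory.EllipticCurves.IwasawaAlgebra Literature.NumberTheory.EllipticCurves.ZpExtension
open Literature.NumberTheory.Automorphic

variable {K : Type} [Field K] [NumberField K] (E : WeierstrassCurve K) [E.IsElliptic] {p : ℕ} [hp : Fact p.Prime]
  (κ : ZpExtension K p) {m : ℕ} (hm : 1 ≤ m) (w : HeightOneSpectrum (𝓞 K))
  [Module (EisensteinCoeff p m 1) (geomTorsion E (p : ℤ))]
  (hN : ∀ (d : EisensteinCoeff p m 1) (n : geomTorsion E (p : ℤ)), d • n = (EisensteinCoeff.residueChar p hm (le_refl 1) d).val • n)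
  (πbar : EisensteinCoeff.Twisted p m 1 (geomTorsion E ((p : ℤ) ^ 1)) →ₗ[EisensteinCoeff p m 1] geomTorsion E (p : ℤ))
  (hbar : IsQuotientBy (κ.eisensteinTwist (E.torsionGaloisModule ((p : ℤ) ^ 1)) hm 1)
    (@IsLocalRing.maximalIdeal _ _ (EisensteinCoeff.isLocalRing_eisensteinCoeff p hm (le_refl 1)))
    (E.torsionGaloisModule (p : ℤ)) πbar)
  (hone : ∀ a : geomTorsion E ((p : ℤ) ^ 1),
    ((πbar (EisensteinCoeff.Twisted.tmul 1 a) : geomTorsion E (p : ℤ)) : geomPoints E) = (a : geomPoints E))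

omit [E.IsElliptic] hp in
/-- `Fil_v E[n]` is stable under the decomposition group, in the `≤ comap` shape consumed by `strictSubgroup` /
`ContinuousRep.subrepresentation` (any curve over `K`). [cite: Howard2004HeegnerKolyvagin, §3.1 (arXiv:1202.6340 p. 15, L56–58)] -/
theorem torsionFilAt_le_comap (v : HeightOneSpectrum (𝓞 K)) (n : ℤ) (g : absoluteGaloisGroup (v.adicCompletion K)) :
    E.torsionFilAt v n ≤ (E.torsionFilAt v n).comap (GaloisRep.toLocal v (E.torsionGaloisModule n) g) := by
  intro P hP
  exact E.smul_mem_torsionFilAt v n g P hP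

/-! ## §1 `π̄ (A ⊗ Fil_w E[p]) = Fil_w E[p]` -/

omit [E.IsElliptic] in
include hN hone in
/-- `π̄` maps `A_{m,1} ⊗ Fil_w E[p]` into `Fil_w E[p]`: `π̄(c ⊗ a) = ε(c) · a` and `E₁(K̄_w)` is a subgroup.
[cite: Howard2004HeegnerKolyvagin, §3.1 and proof of Prop. 2.1.3 (arXiv:1202.6340 p. 15 L56–66)] -/
theorem πbar_mem_torsionFilAt_of_mem_twistedFil {x : EisensteinCoeff.Twisted p m 1 (geomTorsion E ((p : ℤ) ^ 1))}
    (hx : x ∈ (E.ordinaryFiltrationAt w (fun j ↦ E.torsionGaloisModuleReduce p j) (fun _ _ ↦ rfl)).twistedFil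
      (p := p) (m := m) 1) :
    πbar x ∈ E.torsionFilAt w (p : ℤ) := by
  induction hx using Submodule.span_induction with
  | mem y hy =>
    obtain ⟨c, a, ha, rfl⟩ := hy
    have h1 : EisensteinCoeff.Twisted.tmul (p := p) (m := m) (k := 1) c a = c • EisensteinCoeff.Twisted.tmul 1 a := by
      rw [EisensteinCoeff.Twisted.smul_tmul, mul_one]
    rw [h1, map_smul, hN]
    refine Submodule.smul_of_tower_mem _ _ ((E.mem_torsionFilAt_iff w _ _).mpr ?_)
    rw [hone a]
    exact (E.mem_torsionFilAt_iff w _ a).mp ha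
  | zero => rw [map_zero]; exact Submodule.zero_mem _
  | add y z _ _ hy hz => rw [map_add]; exact Submodule.add_mem _ hy hz
  | smul n y _ hy => rw [LinearMap.map_smul_of_tower]; exact Submodule.smul_mem _ n hy

omit [E.IsElliptic] in
include hone in
/-- `π̄` maps `A_{m,1} ⊗ Fil_w E[p]` ONTO `Fil_w E[p]`: `y = π̄(1 ⊗ y)`. [cite: Howard2004HeegnerKolyvagin, §3.1 and proof of Prop. 2.1.3 (arXiv:1202.6340 p. 15)] -/
theorem exists_mem_twistedFil_πbar_eq {y : geomTorsion E (p : ℤ)} (hy : y ∈ E.torsionFilAt w (p : ℤ)) :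
    ∃ x ∈ (E.ordinaryFiltrationAt w (fun j ↦ E.torsionGaloisModuleReduce p j) (fun _ _ ↦ rfl)).twistedFil (p := p) (m := m) 1,
      πbar x = y := by
  let a : geomTorsion E ((p : ℤ) ^ 1) := ⟨(y : geomPoints E), by rw [pow_one]; exact y.2⟩
  have ha : a ∈ E.torsionFilAt w ((p : ℤ) ^ 1) := (E.mem_torsionFilAt_iff w _ a).mpr ((E.mem_torsionFilAt_iff w _ y).mp hy)
  exact ⟨EisensteinCoeff.Twisted.tmul 1 a, (E.ordinaryFiltrationAt w _ (fun _ _ ↦ rfl)).tmul_mem_twistedFil 1 _ ha,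
    Subtype.ext (hone a)⟩

/-! ## §2 Purity: `ker π̄ ∩ (A ⊗ Fil) = [T]·(A ⊗ Fil)` in the adapted basis -/

include hbar in
/-- **Purity at the bottom level.**  At a place `w ∋ p` of good reduction with an ordinary point: if `x ∈ A_{m,1} ⊗ Fil_w E[p]` and
`π̄ x = 0` then `x = [T] • y` with `y ∈ A_{m,1} ⊗ Fil_w E[p]`.  In the `A_{m,1}`-basis `1 ⊗ e⁻¹(δ₀), 1 ⊗ e⁻¹(δ₁)` of `W₁` attached to
an adapted `e : E[p] ≃ (ℤ/p)²` (`Fil = {e · 1 = 0}`), `A ⊗ Fil` is `{repr · 1 = 0}` and `ker π̄ = [T] W₁`.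
[cite: Howard2004HeegnerKolyvagin, §3.1 and Rem. 1.1.4 (arXiv:1202.6340 p. 15 L56–66)] [cite: GreenbergLNM1716, §2 p. 82] -/
theorem exists_eq_mk_X_smul_of_πbar_eq_zero (hpw : (p : 𝓞 K) ∈ w.asIdeal) (hgood : E.HasGoodReductionAt w)
    (hord : ∃ P : localPoints E (w.adicCompletion K), (p : ℤ) • P = 0 ∧ P ∉ E.localKernelOfReduction w)
    {x : EisensteinCoeff.Twisted p m 1 (geomTorsion E ((p : ℤ) ^ 1))}
    (hx : x ∈ (E.ordinaryFiltrationAt w (fun j ↦ E.torsionGaloisModuleReduce p j) (fun _ _ ↦ rfl)).twistedFil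
      (p := p) (m := m) 1) (hx0 : πbar x = 0) :
    ∃ y ∈ (E.ordinaryFiltrationAt w (fun j ↦ E.torsionGaloisModuleReduce p j) (fun _ _ ↦ rfl)).twistedFil (p := p) (m := m) 1,
      x = (Ideal.Quotient.mk _ PowerSeries.X : EisensteinCoeff p m 1) • y := by
  set Φ := E.ordinaryFiltrationAt w (fun j ↦ E.torsionGaloisModuleReduce p j) (fun _ _ ↦ rfl) with hΦ
  set Tbar : EisensteinCoeff p m 1 := Ideal.Quotient.mk _ PowerSeries.X with hTbar
  obtain ⟨e, he⟩ := E.exists_addEquiv_mem_torsionFilAt_iff w hgood hpw hord (j := 1) le_rfl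
  let b := EisensteinCoeff.Twisted.basisOfAddEquiv (m := m) e
  -- `A ⊗ Fil ⊆ {repr · 1 = 0}`
  have hrepr1 : ∀ z ∈ Φ.twistedFil (p := p) (m := m) 1, b.repr z 1 = 0 := by
    intro z hz
    induction hz using Submodule.span_induction with
    | mem y hy =>
      obtain ⟨c, a, ha, rfl⟩ := hy
      rw [EisensteinCoeff.Twisted.basisOfAddEquiv_repr_tmul, (he a).mp ha, ZMod.cast_zero, mul_zero]
    | zero => rw [map_zero, Finsupp.zero_apply]
    | add y z _ _ hy hz => rw [map_add, Finsupp.add_apply, hy, hz, add_zero]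
    | smul n y _ hy =>
      rw [map_zsmul]
      change n • b.repr y 1 = 0
      rw [hy]
      exact zsmul_zero n
  -- `b 0 ∈ A ⊗ Fil`
  have hb0 : ∀ c : EisensteinCoeff p m 1, c • b 0 ∈ Φ.twistedFil (p := p) (m := m) 1 := by
    intro c
    change c • EisensteinCoeff.Twisted.basisOfAddEquiv (m := m) e 0 ∈ _
    rw [EisensteinCoeff.Twisted.basisOfAddEquiv_apply, EisensteinCoeff.Twisted.smul_tmul, mul_one]
    refine Φ.tmul_mem_twistedFil 1 _ ((he _).mpr ?_)
    rw [AddEquiv.apply_symm_apply, Pi.single_eq_of_ne (by decide)]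
  -- decomposition in the basis
  have hsum : ∀ z : EisensteinCoeff.Twisted p m 1 (geomTorsion E ((p : ℤ) ^ 1)), b.repr z 0 • b 0 + b.repr z 1 • b 1 = z := by
    intro z
    have h := b.sum_repr z
    rwa [Fin.sum_univ_two] at h
  -- `π̄ x = 0 ⇒ x = [T] • z`
  letI := EisensteinCoeff.isLocalRing_eisensteinCoeff p hm (le_refl 1)
  have hxker : x ∈ LinearMap.ker πbar := hx0
  rw [hbar.ker_eq, EisensteinCoeff.maximalIdeal_eisensteinCoeff_eq p hm (le_refl 1), Submodule.ideal_span_singleton_smul] at hxker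
  obtain ⟨z, -, rfl⟩ := (Submodule.mem_smul_pointwise_iff_exists _ _ _).mp hxker
  refine ⟨b.repr z 0 • b 0, hb0 _, ?_⟩
  have hx1 : Tbar * b.repr z 1 = 0 := by
    have h := hrepr1 _ hx
    rwa [LinearEquiv.map_smul, Finsupp.smul_apply, smul_eq_mul] at h
  calc Tbar • z = Tbar • (b.repr z 0 • b 0 + b.repr z 1 • b 1) := by rw [hsum]
    _ = (Tbar * b.repr z 0) • b 0 + (Tbar * b.repr z 1) • b 1 := by rw [smul_add, smul_smul, smul_smul]
    _ = Tbar • (b.repr z 0 • b 0) := by rw [hx1, zero_smul, add_zero, smul_smul]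

end WeierstrassCurve

/-! ## §3 Generic: Hom-dévissage on the kernel, `H²(K_w, ker) = 0`, and the lift, from PURITY -/

namespace Literature.NumberTheory.EllipticCurves.ZpExtension.OrdinaryFiltration

open Literature.NumberTheory.GaloisRepresentations Literature.NumberTheory.GaloisRepresentations.DiscreteGaloisModule
open Literature.NumberTheory.GaloisCohomology.Howard2004
open Literature.NumberTheory.EllipticCurves.IwasawaAlgebra Literature.NumberTheory.Automorphic

variable {K : Type} [Field K] [NumberField K] {p : ℕ} [hp : Fact p.Prime] (κ : ZpExtension K p)
  {M : ℕ → Type} [∀ k, AddCommGroup (M k)] [∀ k, TopologicalSpace (M k)] [∀ k, DiscreteTopology (M k)]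
  {ρ : ∀ k, DiscreteGaloisModule K (M k)}
  {t : ∀ k, (ρ (k + 1)).toContRepresentation →ⁱL (ρ k).toContRepresentation} {m : ℕ} (hm : 1 ≤ m)
  {w : HeightOneSpectrum (𝓞 K)} (Φ : OrdinaryFiltration ρ t w)
  {N : Type} [AddCommGroup N] [TopologicalSpace N] [DiscreteTopology N] [Module (EisensteinCoeff p m 1) N]
  (hNmod : ∀ (d : EisensteinCoeff p m 1) (n : N), d • n = (EisensteinCoeff.residueChar p hm (le_refl 1) d).val • n)
  (ρN : DiscreteGaloisModule K N) (πbar : EisensteinCoeff.Twisted p m 1 (M 1) →ₗ[EisensteinCoeff p m 1] N)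
  (hbar : IsQuotientBy (κ.eisensteinTwist (ρ 1) hm 1)
    (@IsLocalRing.maximalIdeal _ _ (EisensteinCoeff.isLocalRing_eisensteinCoeff p hm (le_refl 1))) ρN πbar)
  (hpure : ∀ x ∈ Φ.twistedFil (p := p) (m := m) 1, πbar x = 0 →
    ∃ y ∈ Φ.twistedFil (p := p) (m := m) 1, x = (Ideal.Quotient.mk _ PowerSeries.X : EisensteinCoeff p m 1) • y)

set_option maxHeartbeats 800000 in
include hNmod hbar hpure in
/-- **Hom-dévissage on the kernel of the residual presentation restricted to `Fil_w W₁`.**  If every `Γ_{K_w}`-equivariant additive map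
`Fil_w M₁ → Ω` vanishes and PURITY holds (`x ∈ A ⊗ Fil`, `π̄ x = 0 ⇒ x ∈ [T]·(A ⊗ Fil)`), then every `Γ_{K_w}`-equivariant additive map out of
`K = {x ∈ A_{m,1} ⊗ Fil_w M₁ | π̄ x = 0}` vanishes: `K` is generated by the `[T]^{i+1} c ⊗ a`, killed by descending induction on `i`
(`(1+T)^e ≡ 1 mod [T]`). [cite: Howard2004HeegnerKolyvagin, Lemma 3.2.7 (arXiv:1202.6340 p. 16 L150–156)] [cite: MilneADT2006, Ch. I Cor. 2.3] -/
theorem forall_equivariant_ker_restrict_eq_zero {Ω : Type} [AddCommGroup Ω] (ω : absoluteGaloisGroup (w.adicCompletion K) → Ω →+ Ω)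
    (hFil : ∀ g : Φ.fil 1 →+ Ω,
      (∀ (σ : absoluteGaloisGroup (w.adicCompletion K)) (a : Φ.fil 1),
        g ⟨GaloisRep.toLocal w (ρ 1) σ a, Φ.smul_mem 1 σ a a.2⟩ = ω σ (g a)) → g = 0)
    (K₀ : Submodule ℤ (Φ.twistedFil (p := p) (m := m) 1))
    (hK₀ : ∀ x, x ∈ K₀ ↔ πbar (x : EisensteinCoeff.Twisted p m 1 (M 1)) = 0)
    (f : K₀ →+ Ω)
    (hf : ∀ (σ : absoluteGaloisGroup (w.adicCompletion K)) (x : K₀)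
      (hx' : (⟨GaloisRep.toLocal w (κ.eisensteinTwist (ρ 1) hm 1) σ (x : K₀).1, Φ.twistedFil_le_comap hm 1 σ x.1.2⟩ :
        Φ.twistedFil (p := p) (m := m) 1) ∈ K₀), f ⟨_, hx'⟩ = ω σ (f x)) :
    f = 0 := by
  let Tbar : EisensteinCoeff p m 1 := Ideal.Quotient.mk _ PowerSeries.X
  let u : EisensteinCoeff p m 1 := EisensteinCoeff.onePlusT p m 1
  have hu : u - 1 = Tbar := by
    change EisensteinCoeff.onePlusT p m 1 - 1 = Ideal.Quotient.mk _ PowerSeries.X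
    rw [EisensteinCoeff.onePlusT_def, map_add, map_one, add_sub_cancel_left]
  have hTm : Tbar ^ m = 0 := EisensteinCoeff.mk_X_pow_eq_zero p m
  -- `π̄ (([T] d) • z) = 0`
  have hπT : ∀ (d : EisensteinCoeff p m 1) (z : EisensteinCoeff.Twisted p m 1 (M 1)), πbar ((Tbar * d) • z) = 0 := by
    intro d z
    rw [map_smul, hNmod, map_mul]
    change (EisensteinCoeff.residueChar p hm (le_refl 1) (Ideal.Quotient.mk _ PowerSeries.X) * _).val • πbar z = 0
    rw [EisensteinCoeff.residueChar_mk_X, zero_mul, ZMod.val_zero, zero_smul]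
  have hπ0 : ∀ (i : ℕ) (c : EisensteinCoeff p m 1) (a : M 1), πbar (EisensteinCoeff.Twisted.tmul (Tbar ^ (i + 1) * c) a) = 0 := by
    intro i c a
    have h1 : EisensteinCoeff.Twisted.tmul (p := p) (m := m) (k := 1) (Tbar ^ (i + 1) * c) a =
        (Tbar * (Tbar ^ i * c)) • EisensteinCoeff.Twisted.tmul 1 a := by
      rw [EisensteinCoeff.Twisted.smul_tmul, mul_one, show Tbar * (Tbar ^ i * c) = Tbar ^ (i + 1) * c by ring]
    rw [h1]
    exact hπT _ _
  -- the elements `[T]^{i+1} c ⊗ a` of `K`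
  let el : ℕ → EisensteinCoeff p m 1 → Φ.fil 1 → K₀ := fun i c a ↦
    ⟨⟨EisensteinCoeff.Twisted.tmul (Tbar ^ (i + 1) * c) (a : M 1), Φ.tmul_mem_twistedFil 1 _ a.2⟩, (hK₀ _).mpr (hπ0 i c a)⟩
  have key : ∀ d i, i + 1 + d = m → ∀ (c : EisensteinCoeff p m 1) (a : Φ.fil 1), f (el i c a) = 0 := by
    intro d
    induction d with
    | zero =>
      intro i hi c a
      have h0 : el i c a = 0 := Subtype.ext (Subtype.ext (by
        change EisensteinCoeff.Twisted.tmul (Tbar ^ (i + 1) * c) (a : M 1) = 0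
        rw [Nat.add_zero] at hi
        rw [hi, hTm, zero_mul]
        exact TensorProduct.zero_tmul _ _))
      rw [h0, map_zero]
    | succ d ih =>
      intro i hi c a
      have ih' : ∀ (c : EisensteinCoeff p m 1) (a : Φ.fil 1), f (el (i + 1) c a) = 0 := ih (i + 1) (by omega)
      let g : Φ.fil 1 →+ Ω :=
        { toFun := fun a ↦ f (el i c a)
          map_zero' := by
            have h0 : el i c 0 = 0 := Subtype.ext (Subtype.ext (by
              change EisensteinCoeff.Twisted.tmul (Tbar ^ (i + 1) * c) ((0 : Φ.fil 1) : M 1) = 0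
              rw [ZeroMemClass.coe_zero]
              exact TensorProduct.tmul_zero _ _))
            rw [h0, map_zero]
          map_add' := fun a a' ↦ by
            have hab : el i c (a + a') = el i c a + el i c a' := Subtype.ext (Subtype.ext (by
              change EisensteinCoeff.Twisted.tmul (Tbar ^ (i + 1) * c) ((a + a' : Φ.fil 1) : M 1) =
                EisensteinCoeff.Twisted.tmul (Tbar ^ (i + 1) * c) (a : M 1) + EisensteinCoeff.Twisted.tmul (Tbar ^ (i + 1) * c) (a' : M 1)
              rw [Submodule.coe_add]
              exact TensorProduct.tmul_add _ _ _))
            rw [hab, map_add] }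
      have hg : ∀ (σ : absoluteGaloisGroup (w.adicCompletion K)) (a : Φ.fil 1),
          g ⟨GaloisRep.toLocal w (ρ 1) σ a, Φ.smul_mem 1 σ a a.2⟩ = ω σ (g a) := by
        intro σ a
        obtain ⟨r, hr⟩ : Tbar ∣ u ^ κ.twistExponent (eisensteinLevel (p := p) hm 1)
            (absGaloisRestrict K (w.adicCompletion K) σ) - 1 := by
          rw [← hu]
          simpa only [one_pow] using sub_dvd_pow_sub_pow u 1
            (κ.twistExponent (eisensteinLevel (p := p) hm 1) (absGaloisRestrict K (w.adicCompletion K) σ))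
        have hmemK : (⟨GaloisRep.toLocal w (κ.eisensteinTwist (ρ 1) hm 1) σ (el i c a : K₀).1,
            Φ.twistedFil_le_comap hm 1 σ (el i c a).1.2⟩ : Φ.twistedFil (p := p) (m := m) 1) ∈ K₀ :=
          (hK₀ _).mpr (by
            change πbar (GaloisRep.toLocal w (κ.eisensteinTwist (ρ 1) hm 1) σ (el i c a : K₀).1.1) = 0
            rw [GaloisRep.toLocal_apply, hbar.equivariant, (hK₀ (el i c a)).mp (el i c a).2, map_zero])
        have hact : (⟨_, hmemK⟩ : K₀) =
            el i c ⟨GaloisRep.toLocal w (ρ 1) σ a, Φ.smul_mem 1 σ a a.2⟩ +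
              el (i + 1) (r * c) ⟨GaloisRep.toLocal w (ρ 1) σ a, Φ.smul_mem 1 σ a a.2⟩ := by
          apply Subtype.ext; apply Subtype.ext
          change GaloisRep.toLocal w (κ.eisensteinTwist (ρ 1) hm 1) σ (EisensteinCoeff.Twisted.tmul (Tbar ^ (i + 1) * c) (a : M 1)) =
            EisensteinCoeff.Twisted.tmul (Tbar ^ (i + 1) * c) (GaloisRep.toLocal w (ρ 1) σ a : M 1) +
              EisensteinCoeff.Twisted.tmul (Tbar ^ (i + 1 + 1) * (r * c)) (GaloisRep.toLocal w (ρ 1) σ a : M 1)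
          rw [GaloisRep.toLocal_apply, κ.eisensteinTwist_apply_tmul (ρ 1) hm 1, GaloisRep.toLocal_apply]
          have hcoef : u ^ κ.twistExponent (eisensteinLevel (p := p) hm 1) (absGaloisRestrict K (w.adicCompletion K) σ) *
              (Tbar ^ (i + 1) * c) = Tbar ^ (i + 1) * c + Tbar ^ (i + 1 + 1) * (r * c) := by
            have h1 : u ^ κ.twistExponent (eisensteinLevel (p := p) hm 1) (absGaloisRestrict K (w.adicCompletion K) σ) =
                1 + Tbar * r := by rw [← hr]; ring
            rw [h1]; ring
          rw [hcoef]
          exact TensorProduct.add_tmul _ _ _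
        change f (el i c ⟨GaloisRep.toLocal w (ρ 1) σ a, Φ.smul_mem 1 σ a a.2⟩) = ω σ (f (el i c a))
        rw [← hf σ (el i c a) hmemK, hact, map_add, ih' (r * c), add_zero]
      have hg0 : g = 0 := hFil g hg
      exact DFunLike.congr_fun hg0 a
  have hm1 : ∀ (c : EisensteinCoeff p m 1) (a : Φ.fil 1), f (el 0 c a) = 0 := fun c a ↦ key (m - 1) 0 (by omega) c a
  -- `y ↦ f ([T] • y)` vanishes on `A ⊗ Fil`
  have hT : ∀ (z : EisensteinCoeff.Twisted p m 1 (M 1)) (hz : z ∈ Φ.twistedFil (p := p) (m := m) 1)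
      (hz' : Tbar • z ∈ Φ.twistedFil (p := p) (m := m) 1) (hz'' : (⟨Tbar • z, hz'⟩ : Φ.twistedFil (p := p) (m := m) 1) ∈ K₀),
      f ⟨⟨Tbar • z, hz'⟩, hz''⟩ = 0 := by
    intro z hz
    induction hz using Submodule.span_induction with
    | mem z hz =>
      intro hz' hz''
      obtain ⟨c, a, ha, rfl⟩ := hz
      have hel : (⟨⟨Tbar • EisensteinCoeff.Twisted.tmul c a, hz'⟩, hz''⟩ : K₀) = el 0 c ⟨a, ha⟩ := Subtype.ext (Subtype.ext (by
        change Tbar • EisensteinCoeff.Twisted.tmul c a = EisensteinCoeff.Twisted.tmul (Tbar ^ (0 + 1) * c) a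
        rw [EisensteinCoeff.Twisted.smul_tmul, show Tbar ^ (0 + 1) * c = Tbar * c by ring]))
      rw [hel]
      exact hm1 c ⟨a, ha⟩
    | zero =>
      intro hz' hz''
      have h0 : (⟨⟨Tbar • (0 : EisensteinCoeff.Twisted p m 1 (M 1)), hz'⟩, hz''⟩ : K₀) = 0 :=
        Subtype.ext (Subtype.ext (smul_zero _))
      rw [h0, map_zero]
    | add z z' hzm hz'm ihz ihz' =>
      intro hz' hz''
      have m1 : Tbar • z ∈ Φ.twistedFil (p := p) (m := m) 1 := Φ.smul_mem_twistedFil 1 Tbar hzm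
      have m2 : Tbar • z' ∈ Φ.twistedFil (p := p) (m := m) 1 := Φ.smul_mem_twistedFil 1 Tbar hz'm
      have k1 : (⟨Tbar • z, m1⟩ : Φ.twistedFil (p := p) (m := m) 1) ∈ K₀ :=
        (hK₀ _).mpr (by change πbar ((Tbar) • z) = 0; rw [← mul_one Tbar]; exact hπT 1 z)
      have k2 : (⟨Tbar • z', m2⟩ : Φ.twistedFil (p := p) (m := m) 1) ∈ K₀ :=
        (hK₀ _).mpr (by change πbar ((Tbar) • z') = 0; rw [← mul_one Tbar]; exact hπT 1 z')
      have hadd : (⟨⟨Tbar • (z + z'), hz'⟩, hz''⟩ : K₀) = ⟨⟨Tbar • z, m1⟩, k1⟩ + ⟨⟨Tbar • z', m2⟩, k2⟩ :=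
        Subtype.ext (Subtype.ext (smul_add _ _ _))
      rw [hadd, map_add, ihz m1 k1, ihz' m2 k2, add_zero]
    | smul n z hzm ihz =>
      intro hz' hz''
      have m1 : Tbar • z ∈ Φ.twistedFil (p := p) (m := m) 1 := Φ.smul_mem_twistedFil 1 Tbar hzm
      have k1 : (⟨Tbar • z, m1⟩ : Φ.twistedFil (p := p) (m := m) 1) ∈ K₀ :=
        (hK₀ _).mpr (by change πbar ((Tbar) • z) = 0; rw [← mul_one Tbar]; exact hπT 1 z)
      have hsmul : (⟨⟨Tbar • (n • z), hz'⟩, hz''⟩ : K₀) = n • ⟨⟨Tbar • z, m1⟩, k1⟩ :=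
        Subtype.ext (Subtype.ext (smul_comm _ _ _))
      rw [hsmul, map_zsmul, ihz m1 k1, smul_zero]
  refine AddMonoidHom.ext fun x ↦ ?_
  rw [AddMonoidHom.zero_apply]
  obtain ⟨y, hy, hxy⟩ := hpure x.1.1 x.1.2 ((hK₀ x).mp x.2)
  have hy' : Tbar • y ∈ Φ.twistedFil (p := p) (m := m) 1 := Φ.smul_mem_twistedFil 1 Tbar hy
  have hy'' : (⟨Tbar • y, hy'⟩ : Φ.twistedFil (p := p) (m := m) 1) ∈ K₀ :=
    (hK₀ _).mpr (by change πbar ((Tbar) • y) = 0; rw [← mul_one Tbar]; exact hπT 1 y)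
  have hx : x = ⟨⟨Tbar • y, hy'⟩, hy''⟩ := Subtype.ext (Subtype.ext hxy)
  rw [hx]
  exact hT y hy hy' hy''

end Literature.NumberTheory.EllipticCurves.ZpExtension.OrdinaryFiltration

end
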